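import Mathlib
import HarnessLib
import Summits.NavierStokesRegularity.NavierStokesRegularity.Theses.ImplosionDoor
import Summits.NavierStokesRegularity.NavierStokesRegularity.Theorems.ImplosionDoorTangentialCurlFreeTrivialityStubNotSingularOfZero
import Summits.NavierStokesRegularity.NavierStokesRegularity.Theorems.ImplosionDoorTangentialCurlFreeTrivialityStubSliceZero

/-!
# `ImplosionDoor.TangentialCurlFreeTriviality` (item stmt-NavierStokesRegularity-25306) — PROVED

**Statement (verbatim route decl).**  For a profile `v` of the route's Type-I ancient Oseen-mild class (rate
`‖v(t,x)‖ ≤ C/√(−t)`, continuous on the open slab `(−∞,0) × ℝ³`, unit-viscosity Oseen-mild between negative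
times, divergence-free slices): if every negative slice is sphere-tangential (`⟪v(s,y), y⟫ = 0`) and has zero
radial vorticity moment (`⟪curl v(s)(y), y⟫ = 0`), then `v` is not backward singular at the apex `(0,0)`.

PROOF = the composition `TangentialCurlFreeTriviality_of` of the skeleton of record (line `birth`, planner ns-idea-6,
sha 988c162e…) with its two registered stubs, both landed:
* `stub_sliceZero` (`…TangentialCurlFreeTrivialityStubSliceZero`): slices of the class are real-analytic (tree,
  Lemarié-Rieusset 2016 Thm 9.12 + bounded-mild uniqueness), and a `C²` sphere-tangential divergence-free field
  with zero radial vorticity vanishes identically — harmonic 1-forms on `S²` are zero, proved by Bochner's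
  identity in ambient coordinates (`…TangentialCurlFreeTrivialityBochner`, `…TangentialCurlFreeTrivialityKinematics`):
  for `U = |y|²(w·∇)w + |w|²y`, `div U = |y|² tr((Dw)²) + 2⟪w, Dw y⟫ + |w|² ≥ |w|²` and `∫ k(|y|²) div U = 0`;
* `stub_notSingularOfZero` (`…TangentialCurlFreeTrivialityStubNotSingularOfZero`): a profile vanishing on all
  negative slices is bounded near the apex, hence not backward singular.

HONEST FRAMING: crux K2 of the door route ImplosionDoor (rung N0-LocalTubeDoorImplosion) — a regularity CRITERION
about HYPOTHETICAL blow-up profiles (KNSS-type ancient mild solutions under the door hypotheses).  Nothing here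
proves a Navier–Stokes regularity statement; no summit statement is proved.
-/

noncomputable section

-- the summit and its single sub-problem share the name (CONVENTIONS §1), as in every Theorems file
set_option linter.dupNamespace false

namespace Summit.NavierStokesRegularity.NavierStokesRegularity.Theorems

open Summit.NavierStokesRegularity.NavierStokesRegularity.Theorems.ImplosionDoorTangentialCurlFreeTrivialityStubNotSingularOfZero
open Summit.NavierStokesRegularity.NavierStokesRegularity.Theorems.ImplosionDoorTangentialCurlFreeTrivialityStubSliceZero

/-- **Item stmt-NavierStokesRegularity-25306** (`ImplosionDoor.TangentialCurlFreeTriviality`): a Type-I ancient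
Oseen-mild divergence-free profile that is sphere-tangential and has zero radial vorticity moment on every negative
slice is not backward singular at the apex — every slice vanishes (`stub_sliceZero`: analytic slices + kinematic
rigidity of harmonic 1-forms on spheres), and the zero profile is not backward singular (`stub_notSingularOfZero`).
[cite: Davidson2001, App. (poloidal–toroidal kinematics); folklore] -/
theorem implosionDoor_tangentialCurlFreeTriviality_proof :
    Summit.NavierStokesRegularity.NavierStokesRegularity.Theses.ImplosionDoor.TangentialCurlFreeTriviality := by
  unfold Summit.NavierStokesRegularity.NavierStokesRegularity.Theses.ImplosionDoor.TangentialCurlFreeTriviality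
  intro C v hd hc hm hdiv htan hrad
  exact stub_notSingularOfZero v (stub_sliceZero C v hd hc hm hdiv htan hrad)

end Summit.NavierStokesRegularity.NavierStokesRegularity.Theorems

end
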